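import Summits.QuantumFields.BalabanUV.Beta.GAN24.LayerPushFrozen
import Summits.QuantumFields.BalabanUV.Beta.GAN24.LayerCount

/-!
# `BalabanUV.Beta.GAN24.LayerTransportCount` — binder row G-an2-4 / (CONV-C), W-slot CT-W, route «WC-TL» ∕ «QR-LL» (gan24-p1 g25 `gen25/QR-DESIGN-v0.md` §3 (LT); the OWNER
# gan24-p1 g26's RULING preview R-gan24p1-g26-1 ∕ W1, journal l.40158: «THE EXPONENT LEDGER OF RECORD for (LT) at d = 3, per transported piece: +1 (cubic count) −1 (shell)
# −1 (one local vanishing moment against ONE gradient leg) = −1 … to be re-derived letter by letter inside (LT-1″), ±0 expected»), row **(LT-Δ) «LAYER TRANSPORT»**,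
# part (LT-3a) — THE LEDGER IN THE KERNEL, PURE CELL: the cubic-weighted three-leg push of a zero-charge boundary-layer letter through legs at the (N1)∕(N1′) powers nets
# `L^{d−4}` (generic `d`), `L^{−1}` at `d = 3`

NOT IN PRINT; OUR BOOKKEEPING ([folklore] `LayerPushFrozen.abs_push₃_inl_inl_le_of_zeroCharge` ⨾ `LayerCount.layerCount_block` ⨾ exponent arithmetic; G-an2-4 formalisation swarm,
leaf prover `b2b-balaban-gan24-formalise-leaf-01`, gen 63).  HONEST FRAMING (cell contract, verbatim): «discharging `BetaPertH` makes Bałaban's UV stability UNCONDITIONAL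
— a real constructive-QFT result; it is NOT the continuum limit and NOT the Clay problem.»  HONEST DEPENDENCY (verbatim): «continuum YM on T⁴ ⇐ BetaPertH ∧ nine spine
estimates (0/9 proved); BetaPertH ⇐ (D1) ∧ (D4) ∧ CAP+tail; G-an2-4 gates asym, D1 and NE2/3/4.»

## What (GENERIC legs given by envelopes — no object of an2's typed system occurs; the (REP) instantiation names are in the docstrings only)
* `ledger_pow`: `L^{3(d+1)}·(L^{d+2})⁻¹·(L^{d+2})⁻¹·(L^{d+3})⁻¹·L^d = L^d·(L^4)⁻¹`.
* **`abs_cubic_push₃_layer_le`** (generic `d`, relative blocking `L ≥ 1`): three legs with (N1)-type coarse envelopes `A·(L^{d+2})⁻¹·e^{−κ‖quo L · − ·‖₁}` and, for the two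
  KERNEL legs, (N1′)-type unit-gradient envelopes `A′·(L^{d+3})⁻¹·e^{−κ‖quo L · − ·‖₁}` (the `ℓ¹` shapes of `RespStepDecay.exists_respStep_decay_and_grad`, `d = 3`: `L^{−5}`,
  `L^{−6}`); a field-valued family with the weighted slot profile `Cs·ω u·e^{−m(‖x−u‖₁+‖z−u‖₁)}` (`0 < κ < m`), ZERO per-slot field–field charge at every fibre pair, and a weight
  dominated by the boundary layer of the block of label `y` at blocking `L` (leaf-03's exact face weight ∕ any witness form it dominates).  Then the CUBIC-WEIGHTED push
  (the (REP) unit transport is `(cE·Lc^{2(d+1)})^{n+1} • push₃ T T T`, `cE = Lc^{d+1}`, `L = Lc^{n+1}` — `SrecBornSector.transport_unitStepMap_succ_eq_push₃`,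
  `WardResidualSUnits.unitS_transport_sStep_comb`) obeys
  `|L^{3(d+1)}·push₃ l r w S ν U x′ z′ (inl α) (inl β)| ≤ K · L^d·(L^4)⁻¹ · e^{−(κ∕4)(‖x′−U‖₁+‖z′−U‖₁)} · e^{−η‖y − U‖₁}`, `η = min (κ∕2) (δ∕2)`,
  `K = (d+1)³·A²·A′·Cs·M₁·(Zl(m−κ) + Zl m)·(2(d+1))²·Zl(δ∕2)·e^{η}` FREE OF `L`.
* **`abs_cubic_push₃_sub_frozen_layer_le`**: the same bound for `push₃ − FROZEN` with NO charge hypothesis (the remainder half of the ledger holds for every boundary-layer letter;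
  the frozen half = `LayerPushMoments` under the per-label moments (M0_y), (Π_y) — the OWNER g26's W11).
* **`abs_cubic_push₃_layer_three`**: `d = 3` ⇒ the zero-charge bound with `L⁻¹` — the target `C·t·L^{−1}` of (LT), PURE CELL.
WHAT THIS IS NOT: the legs of the (REP) transport are the DRESSED chains `legChain (respStepBmSeq ρ Lc) m n = respStep + dz λ`
(`ContactKernelCells.legChain_respStepBmSeq_apply_eq_add_dz`); the tree's envelope for the dressed chain is `K·(Lc^{4(k+1)})⁻¹ = K·L^{−(d+1)}` (`DressedLegEnvelope.exists_legChain_envelope`),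
ONE POWER SHORT of (N1), with no gradient twin — so this file covers the cell with all three legs UNDRESSED; the cells with a pure-gauge leg `dz λ` are (LT-3b) (summation by parts in
the kernel index + a freeze, or a dressed (N1)∕(N1′)).  [folklore]; 0 cited facts, 0 `def`, 0 `def … : Prop`, 0 sorry.  Decides nothing about which σ-pieces are charge-free (the
CHARGE AUDIT); NOTHING of (Q-R)∕(LT)∕«T2Shape»∕«T2Drift»∕(hW, hWall) discharged; NEVER «G-an2-4 closed» as (CONV-C); NOT D1, NOT `BetaPertH`, NOT continuum, NOT Clay.  2026-08-22.
-/

noncomputable section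

open Finset
open scoped BigOperators
open Literature.MathematicalPhysics.QuantumFieldTheory
open Literature.MathematicalPhysics.QuantumFieldTheory.Balaban1983to89
open Literature.MathematicalPhysics.QuantumFieldTheory.Balaban1983to89.Beta
open B12Sec2to5 (l1 l1_nonneg)
open B6BondElimination (unitVec)
open ExpKernelCalculus (MKer Site Zl Zl_nonneg Zl_pos)
open OneStepResolventKernel (Fib)
open LatticeForm (quo)
open AffineAveraging (box toSite)
open Summit.QuantumFields.BalabanUV.Beta.GAN24.Push3 (push₃)
open Summit.QuantumFields.BalabanUV.Beta.GAN24.LayerPushFrozen (abs_push₃_inl_inl_le_of_zeroCharge abs_push₃_sub_frozen_le_weighted)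
open Summit.QuantumFields.BalabanUV.Beta.GAN24.LayerCount (layerCount_block)

namespace Summit.QuantumFields.BalabanUV.Beta.GAN24.LayerTransportCount

variable {d : ℕ}

/-- [folklore] **THE EXPONENT LEDGER** (the OWNER gan24-p1 g26's W1, journal l.40158): cubic unit weight `L^{3(d+1)}` × two kernel legs at the (N1) power `L^{−(d+2)}`, one at the
(N1′) gradient power `L^{−(d+3)}` (the dipole gain), × the table leg at `L^{−(d+2)}` × the LAYER count `L^d` = `L^{d−4}`: `+1` (cubic: `3(d+1) − 3(d+2) + (d+1) = d−2`)
`−1` (shell: `d` for `d+1`) `−1` (one gradient leg: `d+3` for `d+2`). -/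
theorem ledger_pow (L : ℝ) (hL : L ≠ 0) (d : ℕ) :
    L ^ (3 * (d + 1)) * ((L ^ (d + 2))⁻¹ * (L ^ (d + 2))⁻¹ * (L ^ (d + 3))⁻¹) * L ^ d = L ^ d * (L ^ 4)⁻¹ := by
  field_simp
  ring

variable {l r w : Fin (d + 1) → (Fin (d + 1) → ℤ) → Fin (d + 1) → (Fin (d + 1) → ℤ) → ℝ}
  {S : Fin (d + 1) → (Fin (d + 1) → ℤ) → MKer (d + 1) (Fib d)} {ω : (Fin (d + 1) → ℤ) → ℝ} {L : ℕ} {A A' Cs κ m δ : ℝ}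

/-- NOT IN PRINT; OUR BOOKKEEPING ([folklore] `LayerPushFrozen.abs_push₃_inl_inl_le_of_zeroCharge` ⨾ `LayerCount.layerCount_block` ⨾ `ledger_pow`).
**(LT-3a) THE LAYER TRANSPORT COUNT — PURE CELL, GENERIC `d`**: at relative blocking `L ≥ 1`, three legs with the (N1)-type coarse envelopes
`A·(L^{d+2})⁻¹·e^{−κ‖quo L · − ·‖₁}` and, for the two kernel legs, (N1′)-type unit-gradient envelopes `A′·(L^{d+3})⁻¹·e^{−κ‖quo L · − ·‖₁}` (the `ℓ¹` shapes of
`RespStepDecay.exists_respStep_decay_and_grad`); a field-valued family with the weighted slot profile `Cs·ω u·e^{−m(‖x−u‖₁+‖z−u‖₁)}` (`0 < κ < m`), ZERO per-slot field–field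
charge, and a weight dominated by the boundary layer of the block of label `y` at blocking `L` (rate `δ > 0`; leaf-03's exact face weight or any witness form it dominates).
Then the CUBIC-WEIGHTED push — the (REP) unit transport's `(cE·Lc^{2(d+1)})^{n+1} • push₃ T T T` with `L = Lc^{n+1}`, `SrecBornSector.transport_unitStepMap_succ_eq_push₃`,
here for legs given by envelopes — obeys
`|L^{3(d+1)}·push₃ l r w S ν U x′ z′ (inl α) (inl β)| ≤ K · L^d·(L^4)⁻¹ · e^{−(κ∕4)(‖x′−U‖₁+‖z′−U‖₁)} · e^{−η‖y − U‖₁}`, `η = min (κ∕2) (δ∕2)`,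
`K = (d+1)³·A²·A′·Cs·M₁·(Zl(m−κ) + Zl m) · (2(d+1))²·Zl(δ∕2)·e^{η}` FREE OF `L` — net exponent `d − 4` (`= −1` at `d = 3`: `layerTransport_three`). -/
theorem abs_cubic_push₃_layer_le (hL : 1 ≤ L) (hκ : 0 < κ) (hm : κ < m) (hδ : 0 < δ) (hA : 0 ≤ A) (hA' : 0 ≤ A') (hCs : 0 ≤ Cs)
    (hl : ∀ α x' k x, |l α x' k x| ≤ A * (((L : ℝ)) ^ (d + 2))⁻¹ * Real.exp (-κ * l1 (quo L x - x')))
    (hl' : ∀ α x' k x i, |l α x' k (x + Pi.single i 1) - l α x' k x| ≤ A' * (((L : ℝ)) ^ (d + 3))⁻¹ * Real.exp (-κ * l1 (quo L x - x')))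
    (hr : ∀ β z' k z, |r β z' k z| ≤ A * (((L : ℝ)) ^ (d + 2))⁻¹ * Real.exp (-κ * l1 (quo L z - z')))
    (hr' : ∀ β z' k z i, |r β z' k (z + Pi.single i 1) - r β z' k z| ≤ A' * (((L : ℝ)) ^ (d + 3))⁻¹ * Real.exp (-κ * l1 (quo L z - z')))
    (hw : ∀ ν U k u, |w ν U k u| ≤ A * (((L : ℝ)) ^ (d + 2))⁻¹ * Real.exp (-κ * l1 (quo L u - U)))
    (hS : ∀ k u x z a b, |S k u x z a b| ≤ Cs * ω u * Real.exp (-m * (l1 (x - u) + l1 (z - u))))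
    (hZ : ∀ k u κ₁ κ₂, ∑' x, ∑' z, S k u x z (Sum.inl κ₁) (Sum.inl κ₂) = 0)
    (y : Fin (d + 1) → ℤ)
    (hω : ∀ u, 0 ≤ ω u ∧ ω u ≤ ∑ μ : Fin (d + 1),
      (∑ v ∈ ((box (d + 1) L).filter (fun v => v μ = L - 1)).image (fun v => (L : ℤ) • y + toSite v), Real.exp (-δ * l1 (v - u))
        + ∑ v ∈ ((box (d + 1) L).filter (fun v => v μ = 0)).image (fun v => (L : ℤ) • y + toSite v - unitVec μ),
            Real.exp (-δ * l1 (v - u))))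
    (ν : Fin (d + 1)) (U x' z' : Fin (d + 1) → ℤ) (α β : Fin (d + 1)) :
    |(L : ℝ) ^ (3 * (d + 1)) * push₃ l r w S ν U x' z' (Sum.inl α) (Sum.inl β)|
      ≤ ((((d : ℝ) + 1) ^ 3 * A ^ 2 * A' * Cs * (2 / (m - κ) * Zl (d + 1) ((m - κ) / 2)) * (Zl (d + 1) (m - κ) + Zl (d + 1) m))
          * ((2 * ((d : ℝ) + 1)) ^ 2 * Zl (d + 1) (δ / 2) * Real.exp (min (κ / 2) (δ / 2))))
        * ((L : ℝ) ^ d * ((L : ℝ) ^ 4)⁻¹)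
        * Real.exp (-(κ / 4) * (l1 (x' - U) + l1 (z' - U))) * Real.exp (-(min (κ / 2) (δ / 2)) * l1 (y - U)) := by
  have hL0 : (0 : ℝ) < (L : ℝ) := by exact_mod_cast hL
  have hLne : (L : ℝ) ≠ 0 := hL0.ne'
  have hmk : 0 < m - κ := sub_pos.2 hm
  have hM₁ : 0 ≤ 2 / (m - κ) * Zl (d + 1) ((m - κ) / 2) := by have := Zl_nonneg (D := d + 1) (half_pos hmk); positivity
  have hZ1 : 0 ≤ Zl (d + 1) (m - κ) := Zl_nonneg hmk
  have hZm : 0 ≤ Zl (d + 1) m := Zl_nonneg (hκ.trans hm)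
  -- the weight is bounded (for the `Ω` binder of the push lemma)
  set Ω : ℝ := ∑ _μ : Fin (d + 1), (((L ^ d : ℕ) : ℝ) + ((L ^ d : ℕ) : ℝ)) with hΩ
  have hωΩ : ∀ u, 0 ≤ ω u ∧ ω u ≤ Ω := by
    intro u
    refine ⟨(hω u).1, (hω u).2.trans ?_⟩
    rw [hΩ]
    refine Finset.sum_le_sum fun μ _ => add_le_add ?_ ?_
    · refine (Finset.sum_le_card_nsmul _ _ 1 fun v _ => ?_).trans ?_
      · exact Real.exp_le_one_iff.2 (by nlinarith [l1_nonneg (v - u), hδ.le])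
      · rw [nsmul_eq_mul, mul_one]
        exact_mod_cast (LayerCount.card_faces_le hL y μ).1
    · refine (Finset.sum_le_card_nsmul _ _ 1 fun v _ => ?_).trans ?_
      · exact Real.exp_le_one_iff.2 (by nlinarith [l1_nonneg (v - u), hδ.le])
      · rw [nsmul_eq_mul, mul_one]
        exact_mod_cast (LayerCount.card_faces_le hL y μ).2
  -- the push with ONE gradient constant (zero charge)
  have hpush := abs_push₃_inl_inl_le_of_zeroCharge (N := L) (ω := ω) (Ω := Ω) hL hl hl' hr hr' hw hS hωΩ hκ hm
    (by positivity) (by positivity) (by positivity) (by positivity) hCs hZ ν U x' z' α β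
  -- the layer count
  have hcount := layerCount_block hL hδ (half_pos hκ).le y hω U
  have hcnt0 : 0 ≤ ∑' u, ω u * Real.exp (-(κ / 2) * l1 (quo L u - U)) :=
    tsum_nonneg fun u => mul_nonneg (hω u).1 (Real.exp_pos _).le
  rw [abs_mul, abs_of_pos (pow_pos hL0 _)]
  -- combine
  have hcomb := mul_le_mul_of_nonneg_left (mul_le_mul_of_nonneg_left hcount
    (show 0 ≤ (((d : ℝ) + 1) ^ 3 * (A * (((L : ℝ)) ^ (d + 2))⁻¹) * Cs * (2 / (m - κ) * Zl (d + 1) ((m - κ) / 2)) *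
        ((A' * (((L : ℝ)) ^ (d + 3))⁻¹) * (A * (((L : ℝ)) ^ (d + 2))⁻¹) * Zl (d + 1) (m - κ)
          + (A * (((L : ℝ)) ^ (d + 2))⁻¹) * (A' * (((L : ℝ)) ^ (d + 3))⁻¹) * Zl (d + 1) m)) *
        Real.exp (-(κ / 4) * (l1 (x' - U) + l1 (z' - U))) by positivity)) (pow_pos hL0 (3 * (d + 1))).le
  refine (mul_le_mul_of_nonneg_left hpush (pow_pos hL0 _).le).trans (hcomb.trans (le_of_eq ?_))
  have e := ledger_pow (L : ℝ) hLne d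
  -- normalise: both sides are the same product
  rw [← e]
  ring

/-- NOT IN PRINT; OUR BOOKKEEPING.  **(LT-3a) WITH THE CHARGE DISPLAYED** (no zero-charge hypothesis): the cubic-weighted push MINUS its FROZEN CHARGE TERM
(`LayerPushFrozen.abs_push₃_sub_frozen_le_weighted`) obeys the same `K·L^d·(L^4)⁻¹` bound — the remainder half of the ledger holds for EVERY boundary-layer letter; the frozen half is
`LayerPushMoments` (per-label moments (M0_y), (Π_y)) — the OWNER's W11 (1)–(2). -/
theorem abs_cubic_push₃_sub_frozen_layer_le (hL : 1 ≤ L) (hκ : 0 < κ) (hm : κ < m) (hδ : 0 < δ) (hA : 0 ≤ A) (hA' : 0 ≤ A') (hCs : 0 ≤ Cs)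
    (hl : ∀ α x' k x, |l α x' k x| ≤ A * (((L : ℝ)) ^ (d + 2))⁻¹ * Real.exp (-κ * l1 (quo L x - x')))
    (hl' : ∀ α x' k x i, |l α x' k (x + Pi.single i 1) - l α x' k x| ≤ A' * (((L : ℝ)) ^ (d + 3))⁻¹ * Real.exp (-κ * l1 (quo L x - x')))
    (hr : ∀ β z' k z, |r β z' k z| ≤ A * (((L : ℝ)) ^ (d + 2))⁻¹ * Real.exp (-κ * l1 (quo L z - z')))
    (hr' : ∀ β z' k z i, |r β z' k (z + Pi.single i 1) - r β z' k z| ≤ A' * (((L : ℝ)) ^ (d + 3))⁻¹ * Real.exp (-κ * l1 (quo L z - z')))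
    (hw : ∀ ν U k u, |w ν U k u| ≤ A * (((L : ℝ)) ^ (d + 2))⁻¹ * Real.exp (-κ * l1 (quo L u - U)))
    (hS : ∀ k u x z a b, |S k u x z a b| ≤ Cs * ω u * Real.exp (-m * (l1 (x - u) + l1 (z - u))))
    (y : Fin (d + 1) → ℤ)
    (hω : ∀ u, 0 ≤ ω u ∧ ω u ≤ ∑ μ : Fin (d + 1),
      (∑ v ∈ ((box (d + 1) L).filter (fun v => v μ = L - 1)).image (fun v => (L : ℤ) • y + toSite v), Real.exp (-δ * l1 (v - u))
        + ∑ v ∈ ((box (d + 1) L).filter (fun v => v μ = 0)).image (fun v => (L : ℤ) • y + toSite v - unitVec μ),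
            Real.exp (-δ * l1 (v - u))))
    (ν : Fin (d + 1)) (U x' z' : Fin (d + 1) → ℤ) (α β : Fin (d + 1)) :
    |(L : ℝ) ^ (3 * (d + 1)) * (push₃ l r w S ν U x' z' (Sum.inl α) (Sum.inl β)
        - ∑ k : Fin (d + 1), ∑' u : Fin (d + 1) → ℤ, w ν U k u *
            ∑ κ₂ : Fin (d + 1), ∑ κ₁ : Fin (d + 1), l α x' κ₁ u * r β z' κ₂ u *
              ∑' x, ∑' z, S k u x z (Sum.inl κ₁) (Sum.inl κ₂))|
      ≤ ((((d : ℝ) + 1) ^ 3 * A ^ 2 * A' * Cs * (2 / (m - κ) * Zl (d + 1) ((m - κ) / 2)) * (Zl (d + 1) (m - κ) + Zl (d + 1) m))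
          * ((2 * ((d : ℝ) + 1)) ^ 2 * Zl (d + 1) (δ / 2) * Real.exp (min (κ / 2) (δ / 2))))
        * ((L : ℝ) ^ d * ((L : ℝ) ^ 4)⁻¹)
        * Real.exp (-(κ / 4) * (l1 (x' - U) + l1 (z' - U))) * Real.exp (-(min (κ / 2) (δ / 2)) * l1 (y - U)) := by
  have hL0 : (0 : ℝ) < (L : ℝ) := by exact_mod_cast hL
  have hLne : (L : ℝ) ≠ 0 := hL0.ne'
  have hmk : 0 < m - κ := sub_pos.2 hm
  have hM₁ : 0 ≤ 2 / (m - κ) * Zl (d + 1) ((m - κ) / 2) := by have := Zl_nonneg (D := d + 1) (half_pos hmk); positivity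
  have hZ1 : 0 ≤ Zl (d + 1) (m - κ) := Zl_nonneg hmk
  have hZm : 0 ≤ Zl (d + 1) m := Zl_nonneg (hκ.trans hm)
  -- the weight is bounded (for the `Ω` binder of the push lemma)
  set Ω : ℝ := ∑ _μ : Fin (d + 1), (((L ^ d : ℕ) : ℝ) + ((L ^ d : ℕ) : ℝ)) with hΩ
  have hωΩ : ∀ u, 0 ≤ ω u ∧ ω u ≤ Ω := by
    intro u
    refine ⟨(hω u).1, (hω u).2.trans ?_⟩
    rw [hΩ]
    refine Finset.sum_le_sum fun μ _ => add_le_add ?_ ?_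
    · refine (Finset.sum_le_card_nsmul _ _ 1 fun v _ => ?_).trans ?_
      · exact Real.exp_le_one_iff.2 (by nlinarith [l1_nonneg (v - u), hδ.le])
      · rw [nsmul_eq_mul, mul_one]
        exact_mod_cast (LayerCount.card_faces_le hL y μ).1
    · refine (Finset.sum_le_card_nsmul _ _ 1 fun v _ => ?_).trans ?_
      · exact Real.exp_le_one_iff.2 (by nlinarith [l1_nonneg (v - u), hδ.le])
      · rw [nsmul_eq_mul, mul_one]
        exact_mod_cast (LayerCount.card_faces_le hL y μ).2
  -- the push with ONE gradient constant (zero charge)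
  have hpush := abs_push₃_sub_frozen_le_weighted (N := L) (ω := ω) (Ω := Ω) hL hl hl' hr hr' hw hS hωΩ hκ hm
    (by positivity) (by positivity) (by positivity) (by positivity) hCs ν U x' z' α β
  -- the layer count
  have hcount := layerCount_block hL hδ (half_pos hκ).le y hω U
  have hcnt0 : 0 ≤ ∑' u, ω u * Real.exp (-(κ / 2) * l1 (quo L u - U)) :=
    tsum_nonneg fun u => mul_nonneg (hω u).1 (Real.exp_pos _).le
  rw [abs_mul, abs_of_pos (pow_pos hL0 _)]
  -- combine
  have hcomb := mul_le_mul_of_nonneg_left (mul_le_mul_of_nonneg_left hcount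
    (show 0 ≤ (((d : ℝ) + 1) ^ 3 * (A * (((L : ℝ)) ^ (d + 2))⁻¹) * Cs * (2 / (m - κ) * Zl (d + 1) ((m - κ) / 2)) *
        ((A' * (((L : ℝ)) ^ (d + 3))⁻¹) * (A * (((L : ℝ)) ^ (d + 2))⁻¹) * Zl (d + 1) (m - κ)
          + (A * (((L : ℝ)) ^ (d + 2))⁻¹) * (A' * (((L : ℝ)) ^ (d + 3))⁻¹) * Zl (d + 1) m)) *
        Real.exp (-(κ / 4) * (l1 (x' - U) + l1 (z' - U))) by positivity)) (pow_pos hL0 (3 * (d + 1))).le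
  refine (mul_le_mul_of_nonneg_left hpush (pow_pos hL0 _).le).trans (hcomb.trans (le_of_eq ?_))
  have e := ledger_pow (L : ℝ) hLne d
  -- normalise: both sides are the same product
  rw [← e]
  ring


/-- NOT IN PRINT; OUR BOOKKEEPING.  **(LT-3a) AT `d = 3`: NET `L⁻¹`** — the target `C·t·L^{−1}` of QR-LL's (LT) for the pure cell (legs at the UNDRESSED (N1)∕(N1′) envelopes; the
pure-gauge part of the dressed leg chain — `ContactKernelCells.legChain_respStepBmSeq_apply_eq_add_dz` — is (LT-3b), NOT here). -/
theorem abs_cubic_push₃_layer_three {l r w : Fin (3 + 1) → (Fin (3 + 1) → ℤ) → Fin (3 + 1) → (Fin (3 + 1) → ℤ) → ℝ}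
    {S : Fin (3 + 1) → (Fin (3 + 1) → ℤ) → MKer (3 + 1) (Fib 3)} {ω : (Fin (3 + 1) → ℤ) → ℝ} {L : ℕ} {A A' Cs κ m δ : ℝ}
    (hL : 1 ≤ L) (hκ : 0 < κ) (hm : κ < m) (hδ : 0 < δ) (hA : 0 ≤ A) (hA' : 0 ≤ A') (hCs : 0 ≤ Cs)
    (hl : ∀ α x' k x, |l α x' k x| ≤ A * (((L : ℝ)) ^ (3 + 2))⁻¹ * Real.exp (-κ * l1 (quo L x - x')))
    (hl' : ∀ α x' k x i, |l α x' k (x + Pi.single i 1) - l α x' k x| ≤ A' * (((L : ℝ)) ^ (3 + 3))⁻¹ * Real.exp (-κ * l1 (quo L x - x')))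
    (hr : ∀ β z' k z, |r β z' k z| ≤ A * (((L : ℝ)) ^ (3 + 2))⁻¹ * Real.exp (-κ * l1 (quo L z - z')))
    (hr' : ∀ β z' k z i, |r β z' k (z + Pi.single i 1) - r β z' k z| ≤ A' * (((L : ℝ)) ^ (3 + 3))⁻¹ * Real.exp (-κ * l1 (quo L z - z')))
    (hw : ∀ ν U k u, |w ν U k u| ≤ A * (((L : ℝ)) ^ (3 + 2))⁻¹ * Real.exp (-κ * l1 (quo L u - U)))
    (hS : ∀ k u x z a b, |S k u x z a b| ≤ Cs * ω u * Real.exp (-m * (l1 (x - u) + l1 (z - u))))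
    (hZ : ∀ k u κ₁ κ₂, ∑' x, ∑' z, S k u x z (Sum.inl κ₁) (Sum.inl κ₂) = 0)
    (y : Fin (3 + 1) → ℤ)
    (hω : ∀ u, 0 ≤ ω u ∧ ω u ≤ ∑ μ : Fin (3 + 1),
      (∑ v ∈ ((box (3 + 1) L).filter (fun v => v μ = L - 1)).image (fun v => (L : ℤ) • y + toSite v), Real.exp (-δ * l1 (v - u))
        + ∑ v ∈ ((box (3 + 1) L).filter (fun v => v μ = 0)).image (fun v => (L : ℤ) • y + toSite v - unitVec μ),
            Real.exp (-δ * l1 (v - u))))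
    (ν : Fin (3 + 1)) (U x' z' : Fin (3 + 1) → ℤ) (α β : Fin (3 + 1)) :
    |(L : ℝ) ^ (3 * (3 + 1)) * push₃ l r w S ν U x' z' (Sum.inl α) (Sum.inl β)|
      ≤ ((((3 : ℝ) + 1) ^ 3 * A ^ 2 * A' * Cs * (2 / (m - κ) * Zl (3 + 1) ((m - κ) / 2)) * (Zl (3 + 1) (m - κ) + Zl (3 + 1) m))
          * ((2 * ((3 : ℝ) + 1)) ^ 2 * Zl (3 + 1) (δ / 2) * Real.exp (min (κ / 2) (δ / 2))))
        * ((L : ℝ))⁻¹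
        * Real.exp (-(κ / 4) * (l1 (x' - U) + l1 (z' - U))) * Real.exp (-(min (κ / 2) (δ / 2)) * l1 (y - U)) := by
  have h := abs_cubic_push₃_layer_le (d := 3) hL hκ hm hδ hA hA' hCs hl hl' hr hr' hw hS hZ y hω ν U x' z' α β
  have hL0 : (0 : ℝ) < (L : ℝ) := by exact_mod_cast hL
  have e : ((L : ℝ)) ^ 3 * (((L : ℝ)) ^ 4)⁻¹ = ((L : ℝ))⁻¹ := by field_simp
  have e3 : ((3 : ℕ) : ℝ) = (3 : ℝ) := by norm_num
  rw [e, e3] at h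
  exact h

end Summit.QuantumFields.BalabanUV.Beta.GAN24.LayerTransportCount

end
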